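import Summits.ValiantsHypothesis.ValiantsHypothesis.Theorems.BarrierLeverChainCertificateSufficesBlocks
import Summits.ValiantsHypothesis.ValiantsHypothesis.Theorems.BarrierLeverTropicalDetCertificateSuffices
import Summits.ValiantsHypothesis.ValiantsHypothesis.Theorems.BarrierLeverTropicalDetCertificatesSymmetries

/-!
# Route BarrierLever — the CHAIN-certificate reduction for UT-D (item 19316), part 3/3:
# «chain certificate ⇒ tropical-determinant certificate», PROVED

Helper file (`--supports stmt-ValiantsHypothesis-19316`; cell valiant-natproofs, rung V4, 𝒟-side;
prover seat val-np-p1; statement and proof plan by planner p1-g9, memo `HOME/p1/UTD-memo-g9.md`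
§3(p), named there `ChainCertificateSuffices` — the analogue of item 19573
`DescentCertificateSuffices` with FORWARD pairs charged). Closes NO item (the planner has not
filed `ChainCertificateSuffices` as an item at the time of writing; `chainCertificateSuffices`
below is stated in the exact shape of item 19573 so that a filed item can quote it). Parts 1/3 and
2/3 (`…ChainCertificateSufficesCycle.lean`, `…ChainCertificateSufficesBlocks.lean`) supply the
chain weight `cwt`, the chain sets `chainSet` and the block lemma `inf_ccost_eq`.

**The statement.** A CHAIN CERTIFICATE for a layout `u, w : Fin r → Finset (Fin h)` is ONE
valuation `e : Fin (h+h) → Fin (h+h) → ℕ` of (row literal, column literal) pairs together with an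
outer assignment `π₀ : Perm (Fin r)` fixing the common points (`u (π₀ j) = w j` whenever the column
point `w j` is a row point) whose CHAIN COST
`Σ_{j : w j not a row point} min chainSet e (u (σ j)) (w j)` is STRICTLY smaller at `σ = π₀` than
at every other assignment fixing the common points. (One table `e` suffices: forward pairs,
backward pairs and loops are pairwise distinct literal pairs, so the memo's three tables
`(f, e, ℓ)` are the restrictions of one `e`.) CONCLUSION: the chain weight
`D = cwt e B`, `B = r·h·E + h·E + 1`, `E = Σ e`, and `π₀` form a tropical-determinant certificate
for `(u, w)` — `π₀` is the unique minimiser of `σ ↦ Σ_j tdet D[ρ u_{σ j}, κ w_j]`, i.e. the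
conclusion of UT-D (item 19316 `TropicalDetCertificatesExist`) for the layout
(`chainCertificateSuffices`, verbatim shape; `hasCert_of_chainCertificate`, as
`UTDSymm.HasCert u w`). COROLLARIES: the same in ANY coordinate order (the memo's `∃ ord`:
`hasCert_of_chainCertificate_relabel`, via the relabelling symmetries
`UTDSymm.hasCert_of_relabelRows/Cols`), with the column bits flipped on any `T`
(`hasCert_of_chainCertificate_flipCols`, via `UTDSymm.hasCert_flipCols_iff`), and TT's
conclusion `∃ H, det (det H[ρ u_i, κ w_j])_{ij} ≠ 0` for every layout with a chain certificate
(`transversalMinor_nonsingular_of_chainCertificate`, via item 19315). §3: DIAGONAL layouts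
(`w = u ∘ κ`) carry the trivial chain certificate (`hasCert_of_diagonal`), hence every
AUTOMORPHIC layout `w j = ((u (κ j)) ∆ S).map α` — in particular every ANTIPODAL layout, e.g.
the antipodal double stars on which the planner's chain-certificate search in the natural bits is
undecided — carries a tropical-determinant certificate (`hasCert_of_automorphic`,
`transversalMinor_nonsingular_of_automorphic`; the item-19717-level statement for these layouts
is prover gen 6's `…Automorphic` file).

**Proof (memo §3(p), as for 19573).** OUTER LEMMA (`sum_inf_lt`): by the block lemma an
assignment fixing the common points costs `|Q|·B +` its chain cost (`Q` = columns that are not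
row points), an assignment moving a common point costs `≥ (|Q|+1)·B`, and `π₀` costs
`≤ |Q|·B + r·h·E < (|Q|+1)·B`; so strict chain-cost optimality of `π₀` makes it the unique optimal
outer assignment. Injectivity of `u`, `w` is not used.

WHAT THIS IS NOT: a REDUCTION only. Its supplier «every injective layout has a chain certificate»
(`ChainCertificatesExist`) is NOT claimed: the planner census certifies all 301 test layouts
`h ≤ 8` incl. every fully symmetric layout `h ≤ 7` (kit j252614, j252648) but is UNDECIDED on the
antipodal DOUBLE STARS `h = 9, 10` (j252682, j252729). The reduction certifies UT-D — hence TT via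
item 19315 — exactly on the layouts carrying a chain certificate. Nothing on UT-D in general, on
TT / TNS / item 19717 for general layouts, on crux stmt-ValiantsHypothesis-14610, or on `VP`
versus `VNP`.

References: planner memo `UTD-memo-g9.md` §3(p) (cell valiant-natproofs); Mulmuley–Vazirani–Vazirani
1987 (isolation of a unique optimal assignment by weights) for context.
-/

-- layout Summits/ValiantsHypothesis/ValiantsHypothesis forces the duplicated namespace component
set_option linter.dupNamespace false

namespace Summit.ValiantsHypothesis.ValiantsHypothesis.Theorems.BarrierLever.ChainCert

open Finset
open Summit.ValiantsHypothesis.ValiantsHypothesis.Theorems.BarrierLever.NearPrincipal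
open Summit.ValiantsHypothesis.ValiantsHypothesis.Theorems.BarrierLever.Descent

variable {h : ℕ}

/-! ## 1. The outer comparison -/

/-- THE OUTER LEMMA: with `B = r·h·E + h·E + 1`, `E ≥ max e`, and `D = cwt e B`, an assignment
fixing the common points costs `|Q|·B +` its chain cost (`Q` = columns that are not row points),
an assignment moving a common point costs `≥ (|Q|+1)·B`, and `π₀` costs `< (|Q|+1)·B`; hence the
strict chain-cost optimality of `π₀` (among assignments fixing the common points) makes `π₀` the
unique optimal outer assignment for `D`. -/
theorem sum_inf_lt {r : ℕ} (u w : Fin r → Finset (Fin h)) (e : Fin (h + h) → Fin (h + h) → ℕ)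
    (E : ℕ) (hE : ∀ p q, e p q ≤ E) (π₀ : Equiv.Perm (Fin r))
    (hπ₀ : ∀ j, (∃ i, u i = w j) → u (π₀ j) = w j)
    (hopt : ∀ σ : Equiv.Perm (Fin r), (∀ j, (∃ i, u i = w j) → u (σ j) = w j) → σ ≠ π₀ →
      ∑ j ∈ univ.filter (fun j => ∀ i, u i ≠ w j), sInf (chainSet e (u (π₀ j)) (w j)) <
        ∑ j ∈ univ.filter (fun j => ∀ i, u i ≠ w j), sInf (chainSet e (u (σ j)) (w j)))
    (σ : Equiv.Perm (Fin r)) (hσ : σ ≠ π₀) :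
    ∑ j, univ.inf' univ_nonempty (ccost e (r * (h * E) + h * E + 1) (u (π₀ j)) (w j)) <
      ∑ j, univ.inf' univ_nonempty (ccost e (r * (h * E) + h * E + 1) (u (σ j)) (w j)) := by
  set B := r * (h * E) + h * E + 1 with hBdef
  clear_value B
  have hhB : h * E ≤ B := by omega
  have hP : ∀ j, (¬ ∀ i, u i ≠ w j) → ∃ i, u i = w j := fun j hn => by
    by_contra hne
    exact hn (fun i hi => hne ⟨i, hi⟩)
  -- (1) upper bound for `π₀`
  have hup : ∑ j, univ.inf' univ_nonempty (ccost e B (u (π₀ j)) (w j)) ≤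
      (univ.filter (fun j => ∀ i, u i ≠ w j)).card * B +
        ∑ j ∈ univ.filter (fun j => ∀ i, u i ≠ w j), sInf (chainSet e (u (π₀ j)) (w j)) := by
    calc ∑ j, univ.inf' univ_nonempty (ccost e B (u (π₀ j)) (w j))
        ≤ ∑ j, (if (∀ i, u i ≠ w j) then B + sInf (chainSet e (u (π₀ j)) (w j)) else 0) := by
          refine sum_le_sum (fun j _ => ?_)
          by_cases hj : ∀ i, u i ≠ w j
          · rw [if_pos hj]
            obtain ⟨τ, hτ⟩ := exists_ccost_eq e B (u (π₀ j)) (w j) (hj (π₀ j))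
            exact (inf'_le _ (mem_univ τ)).trans hτ.le
          · rw [if_neg hj, hπ₀ j (hP j hj)]
            exact (inf'_le _ (mem_univ 1)).trans (ccost_one_self e B (w j)).le
      _ = _ := by rw [← sum_filter, sum_add_distrib, sum_const, smul_eq_mul]
  -- (2) blocks of `σ` with a mismatch cost `≥ B + chain ≥ B`
  have hlowj : ∀ j, u (σ j) ≠ w j → B + sInf (chainSet e (u (σ j)) (w j)) ≤
      univ.inf' univ_nonempty (ccost e B (u (σ j)) (w j)) :=
    fun j hj => le_inf' _ _ (fun τ _ => le_ccost e E B hE hhB _ _ hj τ)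
  by_cases hresp : ∀ j, (∃ i, u i = w j) → u (σ j) = w j
  · -- `σ` fixes the common points: compare the chain costs
    have hlt := hopt σ hresp hσ
    have hlow : (univ.filter (fun j => ∀ i, u i ≠ w j)).card * B +
        ∑ j ∈ univ.filter (fun j => ∀ i, u i ≠ w j), sInf (chainSet e (u (σ j)) (w j)) ≤
        ∑ j, univ.inf' univ_nonempty (ccost e B (u (σ j)) (w j)) := by
      rw [← smul_eq_mul, ← sum_const, ← sum_add_distrib, sum_filter]
      refine sum_le_sum (fun j _ => ?_)
      by_cases hj : ∀ i, u i ≠ w j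
      · rw [if_pos hj]; exact hlowj j (hj (σ j))
      · rw [if_neg hj]; exact Nat.zero_le _
    omega
  · -- `σ` moves a common point: one more paying block
    obtain ⟨j₁, hj₁, hj₁'⟩ : ∃ j, (∃ i, u i = w j) ∧ u (σ j) ≠ w j := by
      by_contra hcon
      apply hresp
      intro j hj
      by_contra hne
      exact hcon ⟨j, hj, hne⟩
    have hPj₁ : ¬ ∀ i, u i ≠ w j₁ := fun hall => by
      obtain ⟨i, hi⟩ := hj₁
      exact hall i hi
    have hlow : (univ.filter (fun j => ∀ i, u i ≠ w j)).card * B + B ≤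
        ∑ j, univ.inf' univ_nonempty (ccost e B (u (σ j)) (w j)) := by
      calc (univ.filter (fun j => ∀ i, u i ≠ w j)).card * B + B
          = ∑ j, ((if (∀ i, u i ≠ w j) then B else 0) + (if j = j₁ then B else 0)) := by
            rw [sum_add_distrib, ← sum_filter, sum_const, smul_eq_mul, sum_ite_eq' univ j₁,
              if_pos (mem_univ _)]
        _ ≤ _ := by
            refine sum_le_sum (fun j _ => ?_)
            by_cases hj : ∀ i, u i ≠ w j
            · have hjj : j ≠ j₁ := fun heq => hPj₁ (heq ▸ hj)
              rw [if_pos hj, if_neg hjj, add_zero]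
              exact le_trans (Nat.le_add_right _ _) (hlowj j (hj (σ j)))
            · rw [if_neg hj, zero_add]
              by_cases hjj : j = j₁
              · rw [if_pos hjj, hjj]
                exact le_trans (Nat.le_add_right _ _) (hlowj j₁ hj₁')
              · rw [if_neg hjj]
                exact Nat.zero_le _
    have hsmall : ∑ j ∈ univ.filter (fun j => ∀ i, u i ≠ w j), sInf (chainSet e (u (π₀ j)) (w j)) ≤
        r * (h * E) := by
      calc ∑ j ∈ univ.filter (fun j => ∀ i, u i ≠ w j), sInf (chainSet e (u (π₀ j)) (w j))
          ≤ ∑ j ∈ univ.filter (fun j => ∀ i, u i ≠ w j), h * E :=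
            sum_le_sum (fun j _ => sInf_chainSet_le e _ _ E hE)
        _ = (univ.filter (fun j => ∀ i, u i ≠ w j)).card * (h * E) := by
            rw [sum_const, smul_eq_mul]
        _ ≤ r * (h * E) :=
            Nat.mul_le_mul_right _ ((card_le_univ _).trans (by rw [Fintype.card_fin]))
    omega

/-! ## 2. The reduction: chain certificate ⇒ tropical-determinant certificate -/

/-- **`ChainCertificateSuffices` (planner memo UTD-memo-g9 §3(p)), in the shape of item 19573.** If
a valuation `e` of the literal pairs and an assignment `π₀` fixing the common points make the CHAIN
cost of `π₀` strictly smaller than that of every other assignment fixing the common points, then the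
chain weight `D = cwt e (r·h·E + h·E + 1)` (`E = Σ e`) and `π₀` form a tropical-determinant
certificate for the layout `(u, w)`: `π₀` is the UNIQUE minimiser of the outer assignment problem
over the tropical determinants `min_τ Σ_a D (ρ_{u (σ j)} a) (κ_{w j} (τ a))` — the conclusion of
UT-D (item 19316 `TropicalDetCertificatesExist`) for `(u, w)`. The chain sets are spelled out
verbatim (loop value if the mismatch set is a singleton; chain values of strictly increasing
covering chains). Injectivity of `u`, `w` is not used. -/
theorem chainCertificateSuffices :
    ∀ (h r : ℕ) (u w : Fin r → Finset (Fin h)), Function.Injective u → Function.Injective w →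
    (∃ (e : Fin (h + h) → Fin (h + h) → ℕ) (π₀ : Equiv.Perm (Fin r)),
      (∀ j, (∃ i, u i = w j) → u (π₀ j) = w j) ∧
      ∀ σ : Equiv.Perm (Fin r), (∀ j, (∃ i, u i = w j) → u (σ j) = w j) → σ ≠ π₀ →
        (∑ j ∈ Finset.univ.filter (fun j => ∀ i, u i ≠ w j),
          sInf {n : ℕ |
            (∃ a : Fin h, (∀ m : Fin h, (m ∈ u (π₀ j) ↔ m ∉ w j) ↔ m = a) ∧
              n = e (if a ∈ u (π₀ j) then Fin.castAdd h a else Fin.natAdd h a)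
                    (if a ∈ w j then Fin.natAdd h a else Fin.castAdd h a)) ∨
            (∃ (k : ℕ) (c : Fin (k + 2) → Fin h), StrictMono c ∧
              (∀ m : Fin h, (m ∈ u (π₀ j) ↔ m ∉ w j) → ∃ i, c i = m) ∧
              n = e (if c (Fin.last (k + 1)) ∈ u (π₀ j) then Fin.castAdd h (c (Fin.last (k + 1)))
                      else Fin.natAdd h (c (Fin.last (k + 1))))
                    (if c 0 ∈ w j then Fin.natAdd h (c 0) else Fin.castAdd h (c 0)) +
                  ∑ i : Fin (k + 1), e (if c i.castSucc ∈ u (π₀ j) then Fin.castAdd h (c i.castSucc)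
                      else Fin.natAdd h (c i.castSucc))
                    (if c i.succ ∈ w j then Fin.natAdd h (c i.succ)
                      else Fin.castAdd h (c i.succ)))}) <
        (∑ j ∈ Finset.univ.filter (fun j => ∀ i, u i ≠ w j),
          sInf {n : ℕ |
            (∃ a : Fin h, (∀ m : Fin h, (m ∈ u (σ j) ↔ m ∉ w j) ↔ m = a) ∧
              n = e (if a ∈ u (σ j) then Fin.castAdd h a else Fin.natAdd h a)
                    (if a ∈ w j then Fin.natAdd h a else Fin.castAdd h a)) ∨
            (∃ (k : ℕ) (c : Fin (k + 2) → Fin h), StrictMono c ∧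
              (∀ m : Fin h, (m ∈ u (σ j) ↔ m ∉ w j) → ∃ i, c i = m) ∧
              n = e (if c (Fin.last (k + 1)) ∈ u (σ j) then Fin.castAdd h (c (Fin.last (k + 1)))
                      else Fin.natAdd h (c (Fin.last (k + 1))))
                    (if c 0 ∈ w j then Fin.natAdd h (c 0) else Fin.castAdd h (c 0)) +
                  ∑ i : Fin (k + 1), e (if c i.castSucc ∈ u (σ j) then Fin.castAdd h (c i.castSucc)
                      else Fin.natAdd h (c i.castSucc))
                    (if c i.succ ∈ w j then Fin.natAdd h (c i.succ)
                      else Fin.castAdd h (c i.succ)))})) →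
    ∃ (D : Fin (h + h) → Fin (h + h) → ℕ) (π₀ : Equiv.Perm (Fin r)),
      ∀ σ : Equiv.Perm (Fin r), σ ≠ π₀ →
        ∑ j, Finset.univ.inf' Finset.univ_nonempty (fun τ : Equiv.Perm (Fin h) =>
          ∑ a : Fin h, D (if a ∈ u (π₀ j) then Fin.castAdd h a else Fin.natAdd h a)
            (if τ a ∈ w j then Fin.natAdd h (τ a) else Fin.castAdd h (τ a))) <
        ∑ j, Finset.univ.inf' Finset.univ_nonempty (fun τ : Equiv.Perm (Fin h) =>
          ∑ a : Fin h, D (if a ∈ u (σ j) then Fin.castAdd h a else Fin.natAdd h a)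
            (if τ a ∈ w j then Fin.natAdd h (τ a) else Fin.castAdd h (τ a))) := by
  intro h r u w _ _ hyp
  obtain ⟨e, π₀, hπ₀, hopt⟩ := hyp
  have hE : ∀ p q, e p q ≤ ∑ p', ∑ q', e p' q' := fun p q =>
    le_trans (single_le_sum (f := fun q' => e p q') (fun _ _ => Nat.zero_le _) (mem_univ q))
      (single_le_sum (f := fun p' => ∑ q', e p' q') (fun _ _ => Nat.zero_le _) (mem_univ p))
  exact ⟨cwt e (r * (h * ∑ p', ∑ q', e p' q') + h * (∑ p', ∑ q', e p' q') + 1), π₀,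
    fun σ hσ => sum_inf_lt u w e _ hE π₀ hπ₀ hopt σ hσ⟩

/-- The same reduction, layout-wise and without the (unused) injectivity hypotheses, concluding the
certificate predicate `UTDSymm.HasCert u w` (= the conclusion of UT-D for `(u, w)`, `Iff.rfl`). -/
theorem hasCert_of_chainCertificate {r : ℕ} (u w : Fin r → Finset (Fin h))
    (e : Fin (h + h) → Fin (h + h) → ℕ) (π₀ : Equiv.Perm (Fin r))
    (hπ₀ : ∀ j, (∃ i, u i = w j) → u (π₀ j) = w j)
    (hopt : ∀ σ : Equiv.Perm (Fin r), (∀ j, (∃ i, u i = w j) → u (σ j) = w j) → σ ≠ π₀ →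
      ∑ j ∈ univ.filter (fun j => ∀ i, u i ≠ w j), sInf (chainSet e (u (π₀ j)) (w j)) <
        ∑ j ∈ univ.filter (fun j => ∀ i, u i ≠ w j), sInf (chainSet e (u (σ j)) (w j))) :
    UTDSymm.HasCert u w := by
  have hE : ∀ p q, e p q ≤ ∑ p', ∑ q', e p' q' := fun p q =>
    le_trans (single_le_sum (f := fun q' => e p q') (fun _ _ => Nat.zero_le _) (mem_univ q))
      (single_le_sum (f := fun p' => ∑ q', e p' q') (fun _ _ => Nat.zero_le _) (mem_univ p))
  exact ⟨cwt e (r * (h * ∑ p', ∑ q', e p' q') + h * (∑ p', ∑ q', e p' q') + 1), π₀,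
    fun σ hσ => sum_inf_lt u w e _ hE π₀ hπ₀ hopt σ hσ⟩

/-- **Chain certificates in ANY coordinate order** (the memo's `∃ ord`): a chain certificate for the
layout read in the coordinate order `γ` — i.e. for the relabelled layout
`((u i).map γ, (w j).map γ)` — is still a tropical-determinant certificate for `(u, w)`
(coordinate relabellings are symmetries of UT-D, `UTDSymm.hasCert_of_relabelRows/Cols`). -/
theorem hasCert_of_chainCertificate_relabel {r : ℕ} (u w : Fin r → Finset (Fin h))
    (γ : Equiv.Perm (Fin h)) (e : Fin (h + h) → Fin (h + h) → ℕ) (π₀ : Equiv.Perm (Fin r))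
    (hπ₀ : ∀ j, (∃ i, u i = w j) → u (π₀ j) = w j)
    (hopt : ∀ σ : Equiv.Perm (Fin r), (∀ j, (∃ i, u i = w j) → u (σ j) = w j) → σ ≠ π₀ →
      ∑ j ∈ univ.filter (fun j => ∀ i, u i ≠ w j),
          sInf (chainSet e ((u (π₀ j)).map γ.toEmbedding) ((w j).map γ.toEmbedding)) <
        ∑ j ∈ univ.filter (fun j => ∀ i, u i ≠ w j),
          sInf (chainSet e ((u (σ j)).map γ.toEmbedding) ((w j).map γ.toEmbedding))) :
    UTDSymm.HasCert u w := by
  have hinj : ∀ x y : Finset (Fin h), x.map γ.toEmbedding = y.map γ.toEmbedding ↔ x = y :=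
    fun x y => (Finset.map_injective γ.toEmbedding).eq_iff
  refine UTDSymm.hasCert_of_relabelCols u w γ (UTDSymm.hasCert_of_relabelRows _ _ γ ?_)
  refine hasCert_of_chainCertificate _ _ e π₀ (fun j hj => ?_) (fun σ hσ hne => ?_)
  · obtain ⟨i, hi⟩ := hj
    exact (hinj _ _).mpr (hπ₀ j ⟨i, (hinj _ _).mp hi⟩)
  · have hσ' : ∀ j, (∃ i, u i = w j) → u (σ j) = w j := fun j hj => by
      obtain ⟨i, hi⟩ := hj
      exact (hinj _ _).mp (hσ j ⟨i, (hinj _ _).mpr hi⟩)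
    have hfilt : univ.filter (fun j => ∀ i, (u i).map γ.toEmbedding ≠ (w j).map γ.toEmbedding) =
        univ.filter (fun j => ∀ i, u i ≠ w j) := by
      refine Finset.filter_congr (fun j _ => ?_)
      exact forall_congr' (fun i => not_congr (hinj _ _))
    rw [hfilt]
    exact hopt σ hσ' hne

/-- **TT on every layout with a chain certificate.** A chain certificate for `(u, w)` makes the
transversal layout matrix `(det H[ρ_{u i}, κ_{w j}])_{i,j}` nonsingular for some complex `H`
(this reduction composed with item 19315 `…TropicalDet.tropicalDetCertificateSuffices`) — the
conclusion of item 19152 `TransversalMinorLayoutsNonsingular` for that layout. -/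
theorem transversalMinor_nonsingular_of_chainCertificate (h r : ℕ) (u w : Fin r → Finset (Fin h))
    (hcert : ∃ (e : Fin (h + h) → Fin (h + h) → ℕ) (π₀ : Equiv.Perm (Fin r)),
      (∀ j, (∃ i, u i = w j) → u (π₀ j) = w j) ∧
      ∀ σ : Equiv.Perm (Fin r), (∀ j, (∃ i, u i = w j) → u (σ j) = w j) → σ ≠ π₀ →
        ∑ j ∈ univ.filter (fun j => ∀ i, u i ≠ w j), sInf (chainSet e (u (π₀ j)) (w j)) <
          ∑ j ∈ univ.filter (fun j => ∀ i, u i ≠ w j), sInf (chainSet e (u (σ j)) (w j))) :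
    ∃ H : Matrix (Fin (h + h)) (Fin (h + h)) ℂ, (Matrix.of fun i j : Fin r =>
      (H.submatrix (fun a : Fin h => if a ∈ u i then Fin.castAdd h a else Fin.natAdd h a)
        (fun c : Fin h => if c ∈ w j then Fin.natAdd h c else Fin.castAdd h c)).det).det ≠ 0 := by
  obtain ⟨e, π₀, hπ₀, hopt⟩ := hcert
  obtain ⟨D, π₁, hπ₁⟩ := hasCert_of_chainCertificate u w e π₀ hπ₀ hopt
  exact TropicalDet.tropicalDetCertificateSuffices h r u w D _ (fun _ _ => rfl) π₁ hπ₁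

/-- Chain certificates with the COLUMN bits flipped on `T` (a cube translation on one side) are
still certificates for `(u, w)` (`UTDSymm.hasCert_flipCols_iff`). With `T = univ` this turns an
ANTIPODAL layout into a diagonal one. -/
theorem hasCert_of_chainCertificate_flipCols {r : ℕ} (u w : Fin r → Finset (Fin h))
    (T : Finset (Fin h)) (e : Fin (h + h) → Fin (h + h) → ℕ) (π₀ : Equiv.Perm (Fin r))
    (hπ₀ : ∀ j, (∃ i, u i = symmDiff (w j) T) → u (π₀ j) = symmDiff (w j) T)
    (hopt : ∀ σ : Equiv.Perm (Fin r),
      (∀ j, (∃ i, u i = symmDiff (w j) T) → u (σ j) = symmDiff (w j) T) → σ ≠ π₀ →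
      ∑ j ∈ univ.filter (fun j => ∀ i, u i ≠ symmDiff (w j) T),
          sInf (chainSet e (u (π₀ j)) (symmDiff (w j) T)) <
        ∑ j ∈ univ.filter (fun j => ∀ i, u i ≠ symmDiff (w j) T),
          sInf (chainSet e (u (σ j)) (symmDiff (w j) T))) :
    UTDSymm.HasCert u w :=
  (UTDSymm.hasCert_flipCols_iff u w T).mp
    (hasCert_of_chainCertificate u (fun j => symmDiff (w j) T) e π₀ hπ₀ hopt)

/-! ## 3. Diagonal and automorphic layouts -/

/-- A DIAGONAL layout (every column point is a row point: `w = u ∘ κ`, `u` injective) carries the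
trivial chain certificate — `π₀ = κ` makes every block an identity block and no other assignment
fixes the common points. -/
theorem hasCert_of_diagonal {r : ℕ} (u : Fin r → Finset (Fin h)) (hu : Function.Injective u)
    (κ : Equiv.Perm (Fin r)) : UTDSymm.HasCert u (u ∘ κ) := by
  refine hasCert_of_chainCertificate u (u ∘ κ) (fun _ _ => 0) κ (fun j _ => rfl) ?_
  intro σ hσ hne
  exact absurd (Equiv.ext (fun j => hu (hσ j ⟨κ j, rfl⟩))) hne

/-- **UT-D on AUTOMORPHIC layouts.** If the column points are the images of a rearrangement of the
row points under a cube automorphism `x ↦ (x ∆ S).map α` — e.g. the ANTIPODAL layouts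
`w j = (u (κ j))ᶜ` (`S = univ`, `α = 1`), among them the antipodal double stars
(`U` = weights `≤ 2`, `W` = weights `≥ h − 2`) on which the planner's chain-certificate search in
the natural bits is undecided — then the layout carries a tropical-determinant certificate: the
diagonal certificate transported by `UTDSymm.hasCert_of_upToSymmetry`. -/
theorem hasCert_of_automorphic {r : ℕ} (u w : Fin r → Finset (Fin h)) (hu : Function.Injective u)
    (κ : Equiv.Perm (Fin r)) (α : Equiv.Perm (Fin h)) (S : Finset (Fin h))
    (hw : ∀ j, w j = (symmDiff (u (κ j)) S).map α.toEmbedding) : UTDSymm.HasCert u w := by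
  refine UTDSymm.hasCert_of_upToSymmetry u w α (Equiv.refl _) S ∅ ?_
  have hu' : Function.Injective (fun i => (symmDiff (u i) S).map α.toEmbedding) := by
    intro i i' hii'
    have h1 : symmDiff (u i) S = symmDiff (u i') S := Finset.map_injective α.toEmbedding hii'
    apply hu
    calc u i = symmDiff (symmDiff (u i) S) S := (symmDiff_symmDiff_cancel_right _ _).symm
      _ = symmDiff (symmDiff (u i') S) S := by rw [h1]
      _ = u i' := symmDiff_symmDiff_cancel_right _ _
  have hcol : (fun j => (symmDiff (w j) ∅).map (Equiv.refl (Fin h)).toEmbedding) =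
      (fun i => (symmDiff (u i) S).map α.toEmbedding) ∘ κ := by
    funext j
    rw [Function.comp_apply, hw j]
    ext a
    simp [Finset.mem_symmDiff]
  rw [hcol]
  exact hasCert_of_diagonal _ hu' κ

/-- TT's conclusion on every automorphic layout (in particular every antipodal one):
`∃ H, det (det H[ρ u_i, κ w_j])_{ij} ≠ 0` (via item 19315). -/
theorem transversalMinor_nonsingular_of_automorphic (h r : ℕ) (u w : Fin r → Finset (Fin h))
    (hu : Function.Injective u) (κ : Equiv.Perm (Fin r)) (α : Equiv.Perm (Fin h))
    (S : Finset (Fin h)) (hw : ∀ j, w j = (symmDiff (u (κ j)) S).map α.toEmbedding) :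
    ∃ H : Matrix (Fin (h + h)) (Fin (h + h)) ℂ, (Matrix.of fun i j : Fin r =>
      (H.submatrix (fun a : Fin h => if a ∈ u i then Fin.castAdd h a else Fin.natAdd h a)
        (fun c : Fin h => if c ∈ w j then Fin.natAdd h c else Fin.castAdd h c)).det).det ≠ 0 := by
  obtain ⟨D, π₁, hπ₁⟩ := hasCert_of_automorphic u w hu κ α S hw
  exact TropicalDet.tropicalDetCertificateSuffices h r u w D _ (fun _ _ => rfl) π₁ hπ₁

end Summit.ValiantsHypothesis.ValiantsHypothesis.Theorems.BarrierLever.ChainCert
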